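import Mathlib.Analysis.SpecialFunctions.Pow.Real
import Mathlib.Analysis.SpecialFunctions.Sqrt
import HarnessLib

/-!
# Route `VirialFluxGap` (YangMills): PATCHING BUDGET — the real arithmetic of the patched Euler field on `X_fix`
# (positivity ∕ drive ∕ divergence budgets at a point; the polynomial scale `s = (A·L^a)⁻¹` that fixes the deficit window `t₀ = s²⁰`)

Toward the deciding crux `VirialFluxGap.PeriodicSoftness` (item stmt-QuantumFields-24141).  At a point of `X_fix` the patched field
`c = ψ·(χ·c¹ + (1 − χ)·c²)` (`ψ = ψ(F/t₀)` the deficit cut-off, `χ = χ_reg`, `c¹ = θ·(H+λ⋆1)⁻¹g` generic, `c²` central) has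
drive `ψ·(χ·θ·d₁ + (1−χ)·d₂)` and divergence `ψ·(χ·div c¹ + (1−χ)·div c² + cross) + (ψ′/t₀)·(χ·θ·d₁ + (1−χ)·d₂)`; the three budget lemmas
below turn the CONDITIONAL point facts (generic facts where `ψχ ≠ 0`, central facts where `ψ(1−χ) ≠ 0`, signed cross term where `ψ ≠ 0`)
into the three clauses of w2's ✓`periodicSoftness_of_smoothFrameField_cutoff` with `2c₁ = 7/16`:

* §1 `pos_budget`, `drive_budget`, ★ `div_budget` (`≤ B − 7/16` from `div c¹ ≤ B − 3/4`, `div c² ≤ B − 1/2`, `cross ≤ 1/16`, signs);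
* §2 the scale: `inv_poly_le_inv_poly` (monotonicity of `(A·L^a)⁻¹`), `pow_succ_le_mul_of_le` ∕ `pow_add_le_mul` (products of factors `≥ s`),
  `sqrt_pow_twenty` and ★ `cross_rate_le` (`4(D/ρ²)(A_G + N)·√(s²⁰) ≤ 1/16` from the atomic facts), `half_window_eq` (`(2A²⁰L^{20a})⁻¹ = s²⁰/2`).

HONEST LABEL: elementary real arithmetic; no field is assembled here; ⟨24141⟩, ⟨22884⟩ remain OPEN; the Yang–Mills mass gap is NOT proved; no
summit is proved by a line.  THEOREMS ONLY (0 `def`, 0 `sorry`), standard axioms.  Explicit-unit seat `ym-line-fcl-p3` g41 (cell ym-idea-1, free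
hands), `--supports stmt-QuantumFields-24141`.  References: [folklore].
-/

set_option autoImplicit false

noncomputable section

namespace Summit.QuantumFields.YangMills.Theorems.VirialFluxGap.PatchingBudget

/-! ## §1 The three budgets at a point -/

/-- **Positivity budget**: `0 ≤ ψ·(χ·(θ·d₁) + (1−χ)·d₂)` when `ψ, χ ∈ [0,1]`, the generic drive is signed where `ψχ ≠ 0` (`θ = 1`, `d₁ ≥ 0`)
and the central drive is signed where `ψ(1−χ) ≠ 0`. [folklore] -/
theorem pos_budget {ψv χv θv d₁ d₂ : ℝ} (hψ0 : 0 ≤ ψv) (hχ0 : 0 ≤ χv) (hχ1 : χv ≤ 1)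
    (h1 : ψv ≠ 0 → χv ≠ 0 → θv = 1 ∧ 0 ≤ d₁) (h2 : ψv ≠ 0 → χv ≠ 1 → 0 ≤ d₂) :
    0 ≤ ψv * (χv * (θv * d₁) + (1 - χv) * d₂) := by
  by_cases hψ : ψv = 0
  · rw [hψ, zero_mul]
  refine mul_nonneg hψ0 (add_nonneg ?_ ?_)
  · by_cases hχ : χv = 0
    · rw [hχ, zero_mul]
    · obtain ⟨hθ, hd⟩ := h1 hψ hχ
      rw [hθ, one_mul]; exact mul_nonneg hχ0 hd
  · by_cases hχ : χv = 1
    · rw [hχ, sub_self, zero_mul]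
    · exact mul_nonneg (by linarith) (h2 hψ hχ)

/-- **Drive budget** (on `{F < t₀/2}`, where `ψ = 1`): `2(1−ε)F ≤ χ·(θ·d₁) + (1−χ)·d₂` when the generic drive holds where `χ ≠ 0` and the
central drive (with `ε_C ≤ ε`) holds where `χ ≠ 1`. [folklore] -/
theorem drive_budget {χv θv d₁ d₂ ε εC F : ℝ} (hχ0 : 0 ≤ χv) (hχ1 : χv ≤ 1) (hF : 0 ≤ F) (hεC : εC ≤ ε)
    (h1 : χv ≠ 0 → θv = 1 ∧ 2 * (1 - ε) * F ≤ d₁) (h2 : χv ≠ 1 → 2 * (1 - εC) * F ≤ d₂) :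
    2 * (1 - ε) * F ≤ χv * (θv * d₁) + (1 - χv) * d₂ := by
  have hA : χv * (2 * (1 - ε) * F) ≤ χv * (θv * d₁) := by
    by_cases hχ : χv = 0
    · rw [hχ, zero_mul, zero_mul]
    · obtain ⟨hθ, hd⟩ := h1 hχ
      rw [hθ, one_mul]; exact mul_le_mul_of_nonneg_left hd hχ0
  have hB : (1 - χv) * (2 * (1 - ε) * F) ≤ (1 - χv) * d₂ := by
    by_cases hχ : χv = 1
    · rw [hχ, sub_self, zero_mul, zero_mul]
    · have hd := h2 hχ
      have hd' : 2 * (1 - ε) * F ≤ d₂ := by nlinarith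
      exact mul_le_mul_of_nonneg_left hd' (by linarith)
  nlinarith

/-- ★ **Divergence budget**: with `ψ, χ ∈ [0,1]`, `ψ′ ≤ 0`, `t₀ > 0`, `B ≥ 3/4`: if `div c¹ ≤ B − 3/4` where `ψχ ≠ 0`, `div c² ≤ B − 1/2` where
`ψ(1−χ) ≠ 0`, the cross term is `≤ 1/16` where `ψ ≠ 0`, and the two drives are signed where `ψ′ ≠ 0` weights them, then
`ψ·(χ·div c¹ + (1−χ)·div c² + cross) + (ψ′/t₀)·(χ·(θ·d₁) + (1−χ)·d₂) ≤ B − 7/16`. [folklore] -/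
theorem div_budget {ψv χv θv dψ t₀ B D₁ D₂ X d₁ d₂ : ℝ}
    (hψ0 : 0 ≤ ψv) (hψ1 : ψv ≤ 1) (hχ0 : 0 ≤ χv) (hχ1 : χv ≤ 1) (hdψ : dψ ≤ 0) (ht₀ : 0 < t₀) (hB : 3 / 4 ≤ B)
    (h3 : ψv ≠ 0 → χv ≠ 0 → D₁ ≤ B - 3 / 4) (h4 : ψv ≠ 0 → χv ≠ 1 → D₂ ≤ B - 1 / 2) (h5 : ψv ≠ 0 → X ≤ 1 / 16)
    (h1 : dψ ≠ 0 → χv ≠ 0 → θv = 1 ∧ 0 ≤ d₁) (h2 : dψ ≠ 0 → χv ≠ 1 → 0 ≤ d₂) :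
    ψv * (χv * D₁ + (1 - χv) * D₂ + X) + dψ / t₀ * (χv * (θv * d₁) + (1 - χv) * d₂) ≤ B - 7 / 16 := by
  -- the `ψ′`-term is `≤ 0`
  have hT : dψ / t₀ * (χv * (θv * d₁) + (1 - χv) * d₂) ≤ 0 := by
    by_cases hd : dψ = 0
    · rw [hd, zero_div, zero_mul]
    · have hin : 0 ≤ χv * (θv * d₁) + (1 - χv) * d₂ := by
        refine add_nonneg ?_ ?_
        · by_cases hχ : χv = 0
          · rw [hχ, zero_mul]
          · obtain ⟨hθ, hd1⟩ := h1 hd hχ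
            rw [hθ, one_mul]; exact mul_nonneg hχ0 hd1
        · by_cases hχ : χv = 1
          · rw [hχ, sub_self, zero_mul]
          · exact mul_nonneg (by linarith) (h2 hd hχ)
      exact mul_nonpos_of_nonpos_of_nonneg (div_nonpos_of_nonpos_of_nonneg hdψ ht₀.le) hin
  -- the `ψ`-term is `≤ ψ·(B − 7/16) ≤ B − 7/16`
  have hS : ψv * (χv * D₁ + (1 - χv) * D₂ + X) ≤ B - 7 / 16 := by
    by_cases hψ : ψv = 0
    · rw [hψ, zero_mul]; linarith
    · have hA : χv * D₁ ≤ χv * (B - 3 / 4) := by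
        by_cases hχ : χv = 0
        · rw [hχ, zero_mul, zero_mul]
        · exact mul_le_mul_of_nonneg_left (h3 hψ hχ) hχ0
      have hB' : (1 - χv) * D₂ ≤ (1 - χv) * (B - 1 / 2) := by
        by_cases hχ : χv = 1
        · rw [hχ, sub_self, zero_mul, zero_mul]
        · exact mul_le_mul_of_nonneg_left (h4 hψ hχ) (by linarith)
      have hX := h5 hψ
      have hin : χv * D₁ + (1 - χv) * D₂ + X ≤ B - 7 / 16 := by nlinarith
      calc ψv * (χv * D₁ + (1 - χv) * D₂ + X) ≤ ψv * (B - 7 / 16) := mul_le_mul_of_nonneg_left hin hψ0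
        _ ≤ 1 * (B - 7 / 16) := mul_le_mul_of_nonneg_right hψ1 (by linarith)
        _ = B - 7 / 16 := one_mul _
  linarith

/-! ## §2 The polynomial scale `s = (A·L^a)⁻¹` -/

/-- Monotonicity of inverse monomials: `(A·L^a)⁻¹ ≤ (A′·L^{a′})⁻¹` when `0 < A′ ≤ A`, `a′ ≤ a`, `1 ≤ L`. [folklore] -/
theorem inv_poly_le_inv_poly {A A' Lr : ℝ} {a a' : ℕ} (hA' : 0 < A') (hAA : A' ≤ A) (haa : a' ≤ a) (hL : 1 ≤ Lr) :
    (A * Lr ^ a)⁻¹ ≤ (A' * Lr ^ a')⁻¹ := by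
  have hL0 : 0 < Lr := by linarith
  have hpow : Lr ^ a' ≤ Lr ^ a := pow_le_pow_right₀ hL haa
  have h1 : 0 < A' * Lr ^ a' := by positivity
  rw [inv_le_inv₀ (lt_of_lt_of_le h1 (mul_le_mul hAA hpow (by positivity) (by linarith))) h1]
  exact mul_le_mul hAA hpow (by positivity) (by linarith)

/-- Product letter: `s^(n+1) ≤ x·y` when `s^n ≤ x`, `s ≤ y`, `0 ≤ s`. [folklore] -/
theorem pow_succ_le_mul_of_le {s x y : ℝ} {n : ℕ} (hs : 0 ≤ s) (hx : s ^ n ≤ x) (hy : s ≤ y) :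
    s ^ (n + 1) ≤ x * y := by
  rw [pow_succ]
  exact mul_le_mul hx hy hs ((pow_nonneg hs n).trans hx)

/-- Product letter: `s^(m+n) ≤ x·y` when `s^m ≤ x`, `s^n ≤ y`, `0 ≤ s`. [folklore] -/
theorem pow_add_le_mul {s x y : ℝ} {m n : ℕ} (hs : 0 ≤ s) (hx : s ^ m ≤ x) (hy : s ^ n ≤ y) :
    s ^ (m + n) ≤ x * y := by
  rw [pow_add]
  exact mul_le_mul hx hy (pow_nonneg hs n) ((pow_nonneg hs m).trans hx)

/-- Quotient letter: `s^(m+n) ≤ x/y` when `s^m ≤ x`, `0 < y ≤ (s^n)⁻¹... ` stated as `y * s^n ≤ 1`. [folklore] -/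
theorem pow_add_le_div {s x y : ℝ} {m n : ℕ} (hs : 0 ≤ s) (hx : s ^ m ≤ x) (hy0 : 0 < y) (hy : y * s ^ n ≤ 1) :
    s ^ (m + n) ≤ x / y := by
  rw [le_div_iff₀ hy0, pow_add]
  have hxn : 0 ≤ x := (pow_nonneg hs m).trans hx
  calc s ^ m * s ^ n * y = s ^ m * (y * s ^ n) := by ring
    _ ≤ x * 1 := mul_le_mul hx hy (by positivity) hxn
    _ = x := mul_one _

/-- `√(s²⁰) = s¹⁰` for `s ≥ 0`. [folklore] -/
theorem sqrt_pow_twenty {s : ℝ} (hs : 0 ≤ s) : Real.sqrt (s ^ 20) = s ^ 10 := by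
  rw [show s ^ 20 = (s ^ 10) ^ 2 by ring, Real.sqrt_sq (pow_nonneg hs 10)]

/-- ★ **The cross-term rate under the window `t₀ = s²⁰`.**  From the atomic facts `D ≤ s⁻¹`, `s ≤ ρ²`, `A_G ≤ 4·s⁻⁷`, `N ≤ s⁻¹`, `0 < s ≤ 1/320`:
`4·(D/ρ²)·(A_G + N)·√(s²⁰) ≤ 1/16`. [folklore] -/
theorem cross_rate_le {s D ρ AG N : ℝ} (hs0 : 0 < s) (hs1 : s ≤ 1 / 320) (hD0 : 0 ≤ D) (hD : D ≤ s⁻¹) (hρ : s ≤ ρ ^ 2)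
    (hAG0 : 0 ≤ AG) (hAG : AG ≤ 4 * (s ^ 7)⁻¹) (hN0 : 0 ≤ N) (hN : N ≤ s⁻¹) :
    4 * (D / ρ ^ 2) * (AG + N) * Real.sqrt (s ^ 20) ≤ 1 / 16 := by
  rw [sqrt_pow_twenty hs0.le]
  have hsle1 : s ≤ 1 := by linarith
  have hρ2 : 0 < ρ ^ 2 := lt_of_lt_of_le hs0 hρ
  -- `D/ρ² ≤ s⁻²`
  have h1 : D / ρ ^ 2 ≤ s⁻¹ * s⁻¹ := by
    rw [div_le_iff₀ hρ2]
    have : s⁻¹ * s⁻¹ * s ≤ s⁻¹ * s⁻¹ * ρ ^ 2 := mul_le_mul_of_nonneg_left hρ (by positivity)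
    have e : s⁻¹ * s⁻¹ * s = s⁻¹ := by field_simp
    rw [e] at this
    exact hD.trans this
  -- `A_G + N ≤ 5·s⁻⁷`
  have h7 : s⁻¹ ≤ (s ^ 7)⁻¹ := by
    rw [inv_le_inv₀ hs0 (by positivity)]
    calc s ^ 7 = s * s ^ 6 := by ring
      _ ≤ s * 1 := mul_le_mul_of_nonneg_left (pow_le_one₀ hs0.le hsle1) hs0.le
      _ = s := mul_one _
  have h2 : AG + N ≤ 5 * (s ^ 7)⁻¹ := by linarith
  have h3 : 4 * (D / ρ ^ 2) * (AG + N) * s ^ 10 ≤ 4 * (s⁻¹ * s⁻¹) * (5 * (s ^ 7)⁻¹) * s ^ 10 := by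
    have hp : 0 ≤ s ^ 10 := by positivity
    have hq : 0 ≤ D / ρ ^ 2 := div_nonneg hD0 hρ2.le
    gcongr
  have e : 4 * (s⁻¹ * s⁻¹) * (5 * (s ^ 7)⁻¹) * s ^ 10 = 20 * s := by field_simp; ring
  rw [e] at h3
  linarith

/-- The window threshold of ✓`periodicSoftness_of_smoothFrameField_cutoff` in the scale: `(2A²⁰·L^{20a})⁻¹ = s²⁰/2` for `s = (A·L^a)⁻¹`. [folklore] -/
theorem half_window_eq {A Lr : ℝ} {a : ℕ} (hA : 0 < A) (hL : 0 < Lr) :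
    (2 * A ^ 20 * Lr ^ ((20 * a : ℕ) : ℝ))⁻¹ = ((A * Lr ^ a)⁻¹) ^ 20 / 2 := by
  rw [Real.rpow_natCast, pow_mul, inv_pow, mul_pow]
  have h : (Lr ^ 20) ^ a = (Lr ^ a) ^ 20 := by rw [← pow_mul, ← pow_mul, mul_comm]
  rw [h]
  field_simp

end Summit.QuantumFields.YangMills.Theorems.VirialFluxGap.PatchingBudget

end
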